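import Summits.KontsevichZagierPeriods.KontsevichZagierPeriods.Theses.VeryGoodTransfer
import Literature.NumberTheory.Transcendental.KZSemiCanonicalReductionProofs
import Literature.NumberTheory.Transcendental.KZLogCalculusProofs

/-!
# Route VeryGoodTransfer — proof of the split child `ResolvedAtlasRealisation` (X₃, calculus of moves)

The third piece of the typed split of `RationalRepsResolve` (crux-strategist, BC2 redirect), stated
verbatim (the child decl is installed by `route edit --split`; a prover then closes it with
`theorem … : VeryGoodTransfer.ResolvedAtlasRealisation := resolvedAtlasRealisation`): an atlas of
injective `ℚ`-semialgebraic differentiable charts `φᵢ` on bounded `ℚ`-semialgebraic pieces `τᵢ`,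
with `ℚ`-semialgebraic images a.e.-partitioning `r.domain` and integrands `gᵢ` that are
`ℚ`-semialgebraic on `τᵢ`, `C¹` on an open neighbourhood of `closure τᵢ` and equal to
`r.integrand ∘ φᵢ · |det φᵢ'|` on `τᵢ`, is realised by the moves: `[r] − ∑ᵢ [τᵢ, gᵢ] ∈ KZ.relations`
(iterated domain additivity `KZ.of_sub_sum_of_mem_relations`, rule (1a), then one
`KZ.changeOfVariablesRel` instance per chart, rule (2)); the `[τᵢ, gᵢ]` are resolved representations.
-/

noncomputable section

open MeasureTheory Set
open Literature.NumberTheory.Transcendental Literature.ModelTheory.ExponentialFields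
open Literature.NumberTheory.Transcendental.KZ

namespace Summit.KontsevichZagierPeriods.VeryGoodTransfer.ResolvedAtlasRealisationProof

/-- **X₃ `ResolvedAtlasRealisation`** (stated verbatim): a resolved atlas is realised by rules (1a) + (2).
[cite: KontsevichZagier2001, §1.2 rules (1), (2)] -/
theorem resolvedAtlasRealisation :
    ∀ (n k : ℕ) (r : Literature.NumberTheory.Transcendental.KZ.IntegralRep n) (τ : Fin k → Set (Fin n → ℝ)) (φ : Fin k → (Fin n → ℝ) → (Fin n → ℝ)) (φ' : Fin k → (Fin n → ℝ) → (Fin n → ℝ) →L[ℝ] (Fin n → ℝ)) (g : Fin k → (Fin n → ℝ) → ℝ) (U : Fin k → Set (Fin n → ℝ)), (∀ i, Literature.ModelTheory.ExponentialFields.IsSemialgebraic ℚ (τ i) ∧ Bornology.IsBounded (τ i) ∧ Literature.NumberTheory.Transcendental.IsSemialgebraicMapOn ℚ (τ i) (φ i) ∧ (∀ x ∈ τ i, HasFDerivWithinAt (φ i) (φ' i x) (τ i) x) ∧ Set.InjOn (φ i) (τ i) ∧ Literature.ModelTheory.ExponentialFields.IsSemialgebraic ℚ (φ i '' τ i) ∧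 φ i '' τ i ⊆ r.domain ∧ IsOpen (U i) ∧ closure (τ i) ⊆ U i ∧ ContDiffOn ℝ 1 (g i) (U i) ∧ Literature.NumberTheory.Transcendental.IsSemialgebraicFunOn ℚ (τ i) (g i) ∧ ∀ x ∈ τ i, g i x = r.integrand (φ i x) * |(φ' i x).det|) → (∀ i j, i ≠ j → MeasureTheory.volume (φ i '' τ i ∩ φ j '' τ j) = 0) → MeasureTheory.volume (r.domain \ ⋃ i, φ i '' τ i) = 0 → ∃ (k' : ℕ) (ρ : Fin k' → Literature.NumberTheory.Transcendental.KZ.IntegralRep n) (ε : Fin k' → ℤ), (∀ i, Bornology.IsBounded (ρ i).domain ∧ ∃ V : Set (Fin n → ℝ), IsOpen V ∧ closure (ρ i).domain ⊆ V ∧ ContDiffOn ℝ 1 (ρ i).integrand V) ∧ Literature.NumberTheory.Transcendental.KZ.of r - ∑ i, ε i • Literature.NumberTheory.Transcendental.KZ.of (ρ i) ∈ Literature.NumberTheory.Transcendental.KZ.relations := by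
  intro n k r τ φ φ' g U hch hdisj hcov
  classical
  have h1 : ∀ i, IsSemialgebraic ℚ (τ i) := fun i => (hch i).1
  have h2 : ∀ i, Bornology.IsBounded (τ i) := fun i => (hch i).2.1
  have h3 : ∀ i, IsSemialgebraicMapOn ℚ (τ i) (φ i) := fun i => (hch i).2.2.1
  have h4 : ∀ i, ∀ x ∈ τ i, HasFDerivWithinAt (φ i) (φ' i x) (τ i) x := fun i => (hch i).2.2.2.1
  have h5 : ∀ i, InjOn (φ i) (τ i) := fun i => (hch i).2.2.2.2.1
  have h6 : ∀ i, IsSemialgebraic ℚ (φ i '' τ i) := fun i => (hch i).2.2.2.2.2.1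
  have h7 : ∀ i, φ i '' τ i ⊆ r.domain := fun i => (hch i).2.2.2.2.2.2.1
  have h8 : ∀ i, IsOpen (U i) := fun i => (hch i).2.2.2.2.2.2.2.1
  have h9 : ∀ i, closure (τ i) ⊆ U i := fun i => (hch i).2.2.2.2.2.2.2.2.1
  have h10 : ∀ i, ContDiffOn ℝ 1 (g i) (U i) := fun i => (hch i).2.2.2.2.2.2.2.2.2.1
  have h11 : ∀ i, IsSemialgebraicFunOn ℚ (τ i) (g i) := fun i => (hch i).2.2.2.2.2.2.2.2.2.2.1
  have h12 : ∀ i, ∀ x ∈ τ i, g i x = r.integrand (φ i x) * |(φ' i x).det| :=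
    fun i => (hch i).2.2.2.2.2.2.2.2.2.2.2
  -- the new integrands are integrable: continuous on the compact closure
  have hint : ∀ i, IntegrableOn (g i) (τ i) := fun i =>
    (((h10 i).continuousOn.mono (h9 i)).integrableOn_compact (h2 i).isCompact_closure).mono_set
      subset_closure
  -- the resolved representations `[τᵢ, gᵢ]` and the traces `[φᵢ(τᵢ), r.integrand]`
  set ρ : Fin k → IntegralRep n := fun i => ⟨τ i, g i, h1 i, h11 i, hint i⟩ with hρ
  set S : Fin k → IntegralRep n := fun i => r.restrict (φ i '' τ i) (h6 i) (h7 i) with hS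
  -- rule (1a): `[r] ≡ ∑ᵢ [Sᵢ]`
  have e1 : of r - ∑ i, of (S i) ∈ relations := by
    refine of_sub_sum_of_mem_relations Finset.univ r S (fun i _ => ?_) (fun i _ _ _ => rfl) ?_ ?_
    · rw [show (S i).domain \ r.domain = ∅ from sdiff_eq_empty.mpr (h7 i), measure_empty]
    · have : r.domain \ ⋃ i ∈ (Finset.univ : Finset (Fin k)), (S i).domain = r.domain \ ⋃ i, φ i '' τ i := by
        congr 1
        ext x
        simp [hS]
      rw [this]
      exact hcov
    · intro i _ j _ hij
      exact hdisj i j hij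
  -- rule (2): `[ρᵢ] − [Sᵢ]` is a change-of-variables move
  have e2 : ∀ i, of (ρ i) - of (S i) ∈ changeOfVariablesRel := fun i =>
    ⟨n, ρ i, S i, φ i, φ' i, h3 i, h4 i, h5 i, rfl, fun x hx => h12 i x hx, rfl⟩
  have e3 : ∑ i, of (ρ i) - ∑ i, of (S i) ∈ relations :=
    sum_sub_sum_mem_relations Finset.univ _ _ fun i _ => changeOfVariablesRel_subset_relations (e2 i)
  refine ⟨k, ρ, fun _ => 1, fun i => ⟨h2 i, U i, h8 i, h9 i, h10 i⟩, ?_⟩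
  have : of r - ∑ i, (1 : ℤ) • of (ρ i) = (of r - ∑ i, of (S i)) - (∑ i, of (ρ i) - ∑ i, of (S i)) := by
    simp only [one_smul]
    abel
  rw [this]
  exact relations.sub_mem e1 e3

end Summit.KontsevichZagierPeriods.VeryGoodTransfer.ResolvedAtlasRealisationProof
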